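import Summits.Ventures.PercRepro.S2ContractionRank

/-!
# PercRepro — S2: THE TOP `m`-SETS THROUGH `W` BY THE CONTRACTION LEVER, EXACT IN THE RANK OF THE TRACE (p7, gen 17; sub-claim S2;
the lever the case `ν = 4` of the cells `(13, 8 …)` needs)

For a top `m`-set `B` (`ρ(B) = 5`, `E ∖ B` spanning) with trace `T = B ∩ W` of size `j` and rank `ρ`, the outside part `X = B ∖ W`
satisfies **`ρ_{M／W}(X) + ρ(T) ≤ 5`** (a basis `J` of `X` in `M／W` together with a basis `K` of `T` extended to a basis of `W` is
`M`-independent inside `B`): `S2.contract_eRk_add_eRk_inter_le`. Hence the exact-rank lever **`S2.ncard_top_le_sum_contract_rank_exact`**: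
`#top_m ≤ Σ_{j ∈ [lo, m]} Σ_{ρ < 6} #{T ⊆ W : |T| = j, ρ(T) = ρ} · #{X ⊆ E ∖ W : |X| = m − j, ρ_{M／W}(X) + ρ ≤ 5}` — the graded
lever of S2ContractionRank with the class `ρ(T) + |X| ≥ 6 ⇒ X dependent` replaced by the exact rank defect `ρ_{M／W}(X) ≤ 5 − ρ(T)`
(a rank-`4` trace leaves `X` of rank `≤ 1` in the contraction, not merely dependent). At `ν = 4`, `w = 9` this lever with the hit
`j ≥ m − 4` (a top set has `|B ∖ W| ≤ nullity(M／W) = 4` because `E ∖ B` spans) reads `≤ 0.38` on every coloop-free model of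
`M／W` (lane mining/nu4_138_refined2.py) where the graded lever read `1.23`. Nothing about any cell is claimed. Axioms: standard.
-/

open scoped Matroid

namespace PercRepro

namespace S2

open Set

variable {α : Type}

/-- The rank of `B ∖ W` in `M ／ W` plus the rank of the trace `B ∩ W` is at most the rank of `B`. -/
theorem contract_eRk_add_eRk_inter_le (M : Matroid α) [M.Finite] {W B : Set α} (hW : W ⊆ M.E) (hB : B ⊆ M.E) :
    (M ／ W).eRk (B \ W) + M.eRk (B ∩ W) ≤ M.eRk B := by
  classical
  have hXE : B \ W ⊆ (M ／ W).E := by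
    rw [Matroid.contract_ground]
    exact Set.sdiff_subset_sdiff_left hB
  obtain ⟨J, hJ⟩ := (M ／ W).exists_isBasis (B \ W) hXE
  have hTE : B ∩ W ⊆ M.E := Set.inter_subset_left.trans hB
  obtain ⟨K, hK⟩ := M.exists_isBasis (B ∩ W) hTE
  obtain ⟨I, hI, hKI⟩ := hK.indep.subset_isBasis_of_subset (hK.subset.trans Set.inter_subset_right) hW
  have hJI : M.Indep (J ∪ I) := ((hI.contract_indep_iff).1 hJ.indep).1
  have hJK : M.Indep (J ∪ K) := hJI.subset (Set.union_subset_union_right J hKI)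
  have hJW : Disjoint J W := by
    have := hJ.subset
    rw [Matroid.contract_ground] at hXE
    exact Set.disjoint_left.2 (fun x hxJ hxW => (hJ.subset hxJ).2 hxW)
  have hdisj : Disjoint J K := hJW.mono_right (hK.subset.trans Set.inter_subset_right)
  have hsub : J ∪ K ⊆ B := Set.union_subset (hJ.subset.trans Set.sdiff_subset) (hK.subset.trans Set.inter_subset_left)
  calc (M ／ W).eRk (B \ W) + M.eRk (B ∩ W) = J.encard + K.encard := by
        rw [hJ.encard_eq_eRk, hK.encard_eq_eRk]
    _ = (J ∪ K).encard := (Set.encard_union_eq hdisj).symm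
    _ ≤ M.eRk B := hJK.encard_le_eRk_of_subset hsub

/-- **The exact-rank contraction lever**: the top `m`-sets through `W`, by the size and the rank of the trace. -/
theorem ncard_top_le_sum_contract_rank_exact (M : Matroid α) [M.Finite] {W : Set α} (hW : W ⊆ M.E) (m lo : ℕ)
    (hhit : ∀ B, B ⊆ M.E → B.ncard = m → M.eRk B = 5 → M.eRk (M.E \ B) = M.eRank → lo ≤ (B ∩ W).ncard) :
    {B : Set α | B ⊆ M.E ∧ B.ncard = m ∧ M.eRk B = 5 ∧ M.eRk (M.E \ B) = M.eRank}.ncard ≤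
      ∑ j ∈ Finset.Icc lo m, ∑ ρ ∈ Finset.range 6,
        {T : Set α | T ⊆ W ∧ T.ncard = j ∧ M.eRk T = (ρ : ℕ∞)}.ncard *
          {X : Set α | X ⊆ M.E \ W ∧ X.ncard = m - j ∧ (M ／ W).eRk X + (ρ : ℕ∞) ≤ 5}.ncard := by
  classical
  set Top := {B : Set α | B ⊆ M.E ∧ B.ncard = m ∧ M.eRk B = 5 ∧ M.eRk (M.E \ B) = M.eRank} with hTop
  have hWfin : W.Finite := M.ground_finite.subset hW
  have hRfin : (M.E \ W).Finite := M.ground_finite.sdiff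
  have hTopfin : Top.Finite := M.ground_finite.finite_subsets.subset (fun B hB => hB.1)
  have hsplit : ∀ B ∈ Top, (B ∩ W).ncard + (B \ W).ncard = m := by
    rintro B ⟨hBE, hBm, -, -⟩
    rw [← hBm]
    exact Set.ncard_inter_add_ncard_sdiff_eq_ncard B W (M.ground_finite.subset hBE)
  -- the classes
  let A : ℕ → ℕ → Set (Set α) := fun j ρ => {B ∈ Top | (B ∩ W).ncard = j ∧ M.eRk (B ∩ W) = (ρ : ℕ∞)}
  have hcover : Top ⊆ ⋃ j ∈ Finset.Icc lo m, ⋃ ρ ∈ Finset.range 6, A j ρ := by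
    intro B hB
    obtain ⟨hBE, hBm, hB5, hBs⟩ := hB
    have hBfin : B.Finite := M.ground_finite.subset hBE
    have hj1 : lo ≤ (B ∩ W).ncard := hhit B hBE hBm hB5 hBs
    have hj2 : (B ∩ W).ncard ≤ m := hBm ▸ Set.ncard_le_ncard Set.inter_subset_left hBfin
    have hrT : M.eRk (B ∩ W) ≤ 5 := hB5 ▸ M.eRk_mono Set.inter_subset_left
    have hne : M.eRk (B ∩ W) ≠ ⊤ := ne_top_of_le_ne_top (by decide) hrT
    refine Set.mem_iUnion₂.2 ⟨(B ∩ W).ncard, Finset.mem_Icc.2 ⟨hj1, hj2⟩, ?_⟩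
    refine Set.mem_iUnion₂.2 ⟨(M.eRk (B ∩ W)).toNat, ?_, ⟨⟨hBE, hBm, hB5, hBs⟩, rfl, (ENat.coe_toNat hne).symm⟩⟩
    rw [Finset.mem_range]
    have : ((M.eRk (B ∩ W)).toNat : ℕ∞) ≤ 5 := by rw [ENat.coe_toNat hne]; exact hrT
    have h5 : (M.eRk (B ∩ W)).toNat ≤ 5 := by exact_mod_cast this
    omega
  -- each class injects into a product
  have hA : ∀ j ρ, (A j ρ).ncard ≤ {T : Set α | T ⊆ W ∧ T.ncard = j ∧ M.eRk T = (ρ : ℕ∞)}.ncard *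
      {X : Set α | X ⊆ M.E \ W ∧ X.ncard = m - j ∧ (M ／ W).eRk X + (ρ : ℕ∞) ≤ 5}.ncard := by
    intro j ρ
    rw [← Set.ncard_prod]
    refine Set.ncard_le_ncard_of_injOn (fun B : Set α => (B ∩ W, B \ W)) ?_ ?_
      ((hWfin.finite_subsets.subset (fun T hT => hT.1)).prod (hRfin.finite_subsets.subset (fun X hX => hX.1)))
    · rintro B ⟨hB, hj, hr⟩
      have hBE : B ⊆ M.E := hB.1
      have hs := hsplit B hB
      have hkey : (M ／ W).eRk (B \ W) + (ρ : ℕ∞) ≤ 5 := by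
        rw [← hr]
        exact (contract_eRk_add_eRk_inter_le M hW hBE).trans (le_of_eq hB.2.2.1)
      refine Set.mem_prod.2 ⟨⟨Set.inter_subset_right, hj, hr⟩, ⟨Set.sdiff_subset_sdiff_left hBE, ?_, hkey⟩⟩
      show (B \ W).ncard = m - j
      omega
    · rintro B₁ - B₂ - hEq
      simp only [Prod.mk.injEq] at hEq
      rw [← Set.inter_union_sdiff B₁ W, ← Set.inter_union_sdiff B₂ W, hEq.1, hEq.2]
  calc Top.ncard ≤ (⋃ j ∈ Finset.Icc lo m, ⋃ ρ ∈ Finset.range 6, A j ρ).ncard :=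
        Set.ncard_le_ncard hcover (Set.Finite.biUnion (Finset.Icc lo m).finite_toSet
          (fun j _ => Set.Finite.biUnion (Finset.range 6).finite_toSet
            (fun ρ _ => hTopfin.subset (fun B hB => hB.1))))
    _ ≤ ∑ j ∈ Finset.Icc lo m, (⋃ ρ ∈ Finset.range 6, A j ρ).ncard := Finset.set_ncard_biUnion_le _ _
    _ ≤ ∑ j ∈ Finset.Icc lo m, ∑ ρ ∈ Finset.range 6, (A j ρ).ncard :=
        Finset.sum_le_sum (fun j _ => Finset.set_ncard_biUnion_le _ _)
    _ ≤ _ := Finset.sum_le_sum (fun j _ => Finset.sum_le_sum (fun ρ _ => hA j ρ))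

end S2

end PercRepro
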